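import Mathlib
import Literature.NumberTheory.Automorphic.ClozelAlgebraicity
import Literature.NumberTheory.Automorphic.AutomorphicRepsGLSatakeFlathProofs
import Literature.NumberTheory.Automorphic.HarishChandraFinitenessGL
import Literature.NumberTheory.Automorphic.GLnCuspidalSpectrumSiegel
import Literature.NumberTheory.Automorphic.AutomorphicFormsSpan
import Literature.NumberTheory.Automorphic.CuspidalRepDataOfCuspFormInfChar
import Literature.NumberTheory.Automorphic.LeviConstantTermIdeal
import Literature.NumberTheory.Automorphic.AutomorphicRepsGLPeterssonAdmissible
import Literature.NumberTheory.Automorphic.AutomorphicRepDataSplitCenter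
import Summits.Langlands.Langlands.Theorems.IrreducibilityBySelfDualityHeckeEigenvalueFieldStubA
import Summits.Langlands.Langlands.Theorems.IrreducibilityBySelfDualityHeckeEigenvalueFieldStubB
import Summits.Langlands.Langlands.Theorems.IrreducibilityBySelfDualityHeckeEigenvalueFieldStubC1
import Summits.Langlands.Langlands.Theorems.IrreducibilityBySelfDualityHeckeEigenvalueFieldStubC2
import Summits.Langlands.Langlands.Theorems.IrreducibilityBySelfDualityHeckeEigenvalueFieldStubC3
import HarnessLib

/-!
# Crux `HeckeEigenvalueField` (stmt-Langlands-13632), line `BaireSketch` — (S4): countability of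
# the unramified Hecke eigensystem germs of regular algebraic cuspidal representations

Supports file for the crux `Summit.Langlands.Langlands.Theses.IrreducibilityBySelfDuality.HeckeEigenvalueField`
(= `Literature.NumberTheory.Automorphic.Clozel1990_heckeEigenvalueField`, Clozel 1990 Thm. 3.13 in
Hecke-eigenvalue form).  Statement (S4) of the line (`countable_heckeEigensystems`, `S4_of_stubs`):
for fixed `n` and number field `K` there is a COUNTABLE set `𝒞` of functions on
(finite places × `{0,…,n}`) such that the unramified Hecke eigensystem
`(v, i) ↦ t_{v,i}(π) = q_v^{i(n-i)/2} e_i(α_v)` of every regular algebraic cuspidal `π` on `GL_n(𝔸_K)`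
agrees with a member of `𝒞` at all but finitely many places.

Proof (assembled from the landed stubs of the line): `𝒞` is indexed by a level `𝔫 ≠ 0`, an ideal
`J` of finite codimension of `Z(𝔤𝔩_n(K_∞))` from the countable family of `stub_B` (the infinity type
of a regular algebraic `π` pins, through the Harish-Chandra homomorphism, the scalars by which the
generators of `Z(𝔤)` act on `W/W'`; a generalised eigenvector of `W ∖ W'` is killed by a power
ideal), and a degree `d` of the polynomial `K_∞`-filtration `M d` of `stub_A` (smearing a form by a
polynomial on `K_∞` puts its `K_∞`-slices in some `M d` without leaving `W ∖ W'`); for each index the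
space of automorphic forms of level `K(𝔫)`, killed by `J`, with slices in `M d` is finite-dimensional
(Harish-Chandra, `harishChandra_finiteness_holds`) and stable under the integral Hecke operators
`T_{v,i}`, `v ∤ 𝔫` (`stub_C1`), which act on its intersection with `W` modulo `W'` by the unramified
Hecke eigenvalues (`stub_C2`); finitely many simultaneous eigencharacters occur on its Hecke-stable
subquotients (`stub_C3`).  `IsRegularAlgebraic` is load-bearing (it enters through `stub_B`; without it
(S4) is false: `Negative/FalseWithoutIsRegularAlgebraic.lean`).

References: Harish-Chandra, *Automorphic forms on semisimple Lie groups*, LNM 62 (1968), Thm. 1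
[HarishChandra1968]; A. Borel, H. Jacquet, *Automorphic forms and automorphic representations*,
Corvallis I (1979) §4 [BorelJacquet1979]; L. Clozel, *Motifs et formes automorphes*, Ann Arbor 1988
(1990), §3 [Clozel1990].
-/

set_option linter.dupNamespace false -- project-wide: `Summit.Langlands.Langlands` is the mandated namespace

noncomputable section

open scoped Pointwise Classical Polynomial
open Filter NumberField NumberField.mixedEmbedding IsDedekindDomain UniversalEnvelopingAlgebra Polynomial
open Literature.NumberTheory.Automorphic

namespace Summit.Langlands.Langlands.Theorems.HeckeEigenvalueField.Baire

variable {n : ℕ} {K : Type} [Field K] [NumberField K]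
/-! ## Assembly of S4 from the stubs A, B, C1, C2, C3 -/

/-- The ring of integers of a number field is countable (a finite free `ℤ`-module). [folklore] -/
theorem countable_ringOfIntegers : Countable (𝓞 K) := by
  let b := NumberField.RingOfIntegers.basis K
  haveI : Countable (Module.Free.ChooseBasisIndex ℤ (𝓞 K) → ℤ) := inferInstance
  exact Countable.of_equiv _ b.equivFun.symm.toEquiv

/-- The ideals of the ring of integers of a number field form a countable set (each is generated
by a finite subset of the countable ring `𝓞 K`). [folklore] -/
theorem countable_ideal_ringOfIntegers : Countable (Ideal (𝓞 K)) := by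
  haveI : Countable (𝓞 K) := countable_ringOfIntegers
  have hsurj : Function.Surjective (fun s : Finset (𝓞 K) => Ideal.span (s : Set (𝓞 K))) := by
    intro I
    obtain ⟨s, hs⟩ := (inferInstance : IsNoetherianRing (𝓞 K)).noetherian I
    exact ⟨s, hs⟩
  exact hsurj.countable

set_option maxHeartbeats 400000 in -- one long assembly proof (≈ 220 lines of bookkeeping over five stubs); default budget is marginal
/-- **(S4), proved from the stubs.** For fixed `n, K`: a countable set of functions on
(places × `{0,…,n}`) such that the unramified Hecke eigensystem of every regular algebraic cuspidal
`π` on `GL_n(𝔸_K)` agrees with one of them at all but finitely many places.  The countable set is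
indexed by (level `𝔫`, ideal `J ∈ 𝒥` of stub B, degree `d` of stub A) and, for each index, by the
finitely many (stub C3) Hecke eigencharacters (stub C1: the `T_{v,i}` preserve the Harish-Chandra
space, finite-dimensional by `harishChandra_finiteness_holds`) on subquotients; a given `π` is
read on a `K(𝔫)`-fixed form of `W ∖ W'` killed by `J` with slices in `M d` (stubs B, A), on which
`T_{v,i}` acts modulo `W'` by the unramified Hecke eigenvalue (stub C2). [folklore] -/
theorem countable_heckeEigensystems (hcpt : isCompact_glFiniteIntegralLevel n K) :
    ∃ 𝒞 : Set (HeightOneSpectrum (𝓞 K) × Fin (n + 1) → ℂ), 𝒞.Countable ∧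
      ∀ π : CuspidalAutomorphicRepData n K hcpt, π.1.IsRegularAlgebraic →
        ∃ c ∈ 𝒞, ∀ᶠ v in cofinite, ∀ α : Multiset ℂ, π.1.HasSatakeParamAt v α →
          ∀ i : Fin (n + 1), heckeEigenvalueOf n v α i = c (v, i) := by
  classical
  letI : MeasurableSpace (AdeleRing (𝓞 K) K) := borel _
  haveI : BorelSpace (AdeleRing (𝓞 K) K) := ⟨rfl⟩
  obtain ⟨M, hMfin, hMstab, hA⟩ := stub_A (n := n) (K := K) hcpt
  obtain ⟨𝒥, h𝒥c, h𝒥fin, hB⟩ := stub_B (n := n) (K := K) hcpt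
  -- a uniformizer at every finite place
  have hϖex : ∀ v : HeightOneSpectrum (𝓞 K), ∃ ϖ : (v.adicCompletion K)ˣ,
      Valued.v (ϖ : v.adicCompletion K) = WithZero.exp (-1 : ℤ) :=
    fun v => exists_valuation_eq_exp_neg_one K v
  choose ϖ hϖ using hϖex
  -- the Harish-Chandra sets `S 𝔫 J d`
  obtain ⟨S, hS⟩ : ∃ S : Ideal (𝓞 K) → Ideal (centerU (archGroupGL n K)) → ℕ →
      Set ((AdelicGroupData.gl n K).Adelic → ℂ), S = fun 𝔫 J d =>
        {φ : (AdelicGroupData.gl n K).Adelic → ℂ |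
          IsAutomorphicForm (AutomorphyDatum.gl n K hcpt) φ ∧
          IsRightInvariantUnder (principalCongruenceLevel n K 𝔫) φ ∧
          (∀ (p : FreeAlgebra ℝ (archGroupGL n K).lie) (hp : IsCentralWord p),
            (⟨freeToEnveloping (archGroupGL n K) p, hp⟩ : centerU (archGroupGL n K)) ∈ J →
              applyFree (AutomorphyDatum.gl n K hcpt).ofArch p φ = 0) ∧
          ∀ g : (AdelicGroupData.gl n K).Adelic,
            (fun k : Kinf n K => φ (g * (AutomorphyDatum.gl n K hcpt).ofK k)) ∈ M d} := ⟨_, rfl⟩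
  -- the Hecke operators `T_{v,i}(ϖ_v)` at level `K(𝔫)`, set to `0` at `v ∣ 𝔫`
  obtain ⟨T, hT⟩ : ∃ T : Ideal (𝓞 K) → HeightOneSpectrum (𝓞 K) × Fin (n + 1) →
      Module.End ℂ ((AdelicGroupData.gl n K).Adelic → ℂ), T =
        fun (𝔫 : Ideal (𝓞 K)) (p : HeightOneSpectrum (𝓞 K) × Fin (n + 1)) =>
        if ¬ p.1.asIdeal ∣ 𝔫 then
          heckeOperator (rightTranslation (AdelicGroupData.gl n K)) (principalCongruenceLevel n K 𝔫)
            (heckeDiagAt n K p.1 (ϖ p.1) (p.2 : ℕ))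
        else 0 := ⟨_, rfl⟩
  have hT₁ : ∀ (𝔫 : Ideal (𝓞 K)) (q : HeightOneSpectrum (𝓞 K) × Fin (n + 1)), ¬ q.1.asIdeal ∣ 𝔫 →
      T 𝔫 q = heckeOperator (rightTranslation (AdelicGroupData.gl n K)) (principalCongruenceLevel n K 𝔫)
        (heckeDiagAt n K q.1 (ϖ q.1) (q.2 : ℕ)) := by
    intro 𝔫 q h
    rw [hT]
    exact if_pos h
  have hT₀ : ∀ (𝔫 : Ideal (𝓞 K)) (q : HeightOneSpectrum (𝓞 K) × Fin (n + 1)), ¬ ¬ q.1.asIdeal ∣ 𝔫 →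
      T 𝔫 q = 0 := by
    intro 𝔫 q h
    rw [hT]
    exact if_neg h
  -- the eigencharacters on subquotients of the span of `S 𝔫 J d`
  obtain ⟨F, hF⟩ : ∃ F : Ideal (𝓞 K) → Ideal (centerU (archGroupGL n K)) → ℕ →
      Set (HeightOneSpectrum (𝓞 K) × Fin (n + 1) → ℂ), F = fun 𝔫 J d =>
        {χ | ∃ (Y Y' : Submodule ℂ ((AdelicGroupData.gl n K).Adelic → ℂ)),
          Y ≤ Submodule.span ℂ (S 𝔫 J d) ∧ Y' ≤ Submodule.span ℂ (S 𝔫 J d) ∧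
          (∀ i, ∀ y ∈ Y, T 𝔫 i y ∈ Y) ∧ (∀ i, ∀ y ∈ Y', T 𝔫 i y ∈ Y') ∧
          ∃ y ∈ Y, y ∉ Y' ∧ ∀ i, T 𝔫 i y - χ i • y ∈ Y'} := ⟨_, rfl⟩
  -- the Hecke operators preserve the spans (stub C1)
  have hTS : ∀ {𝔫 : Ideal (𝓞 K)}, 𝔫 ≠ 0 → ∀ (J : Ideal (centerU (archGroupGL n K))) (d : ℕ)
      (i : HeightOneSpectrum (𝓞 K) × Fin (n + 1)),
      ∀ x ∈ Submodule.span ℂ (S 𝔫 J d), T 𝔫 i x ∈ Submodule.span ℂ (S 𝔫 J d) := by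
    intro 𝔫 h𝔫 J d i x hx
    by_cases hvi : ¬ i.1.asIdeal ∣ 𝔫
    · rw [hT₁ 𝔫 i hvi]
      refine (Submodule.span_le (p := (Submodule.span ℂ (S 𝔫 J d)).comap
        (heckeOperator (rightTranslation (AdelicGroupData.gl n K)) (principalCongruenceLevel n K 𝔫)
          (heckeDiagAt n K i.1 (ϖ i.1) (i.2 : ℕ))))).2 (fun φ hφ => ?_) hx
      refine Submodule.subset_span ?_
      rw [hS] at hφ ⊢
      exact stub_C1 hcpt h𝔫 J (M d) (hMstab d) hvi (ϖ i.1) i.2 hφ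
    · rw [hT₀ 𝔫 i hvi, LinearMap.zero_apply]
      exact Submodule.zero_mem _
  refine ⟨insert 0 (⋃ 𝔫 ∈ {𝔫 : Ideal (𝓞 K) | 𝔫 ≠ 0}, ⋃ J ∈ 𝒥, ⋃ d : ℕ, F 𝔫 J d), ?_, ?_⟩
  · -- countability: finitely many eigencharacters for each index (HC finiteness + stub C3)
    haveI : Countable (Ideal (𝓞 K)) := countable_ideal_ringOfIntegers
    refine Set.Countable.insert _ (Set.Countable.biUnion (Set.to_countable _) fun 𝔫 h𝔫 =>
      Set.Countable.biUnion h𝒥c fun J hJ => Set.countable_iUnion fun d => ?_)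
    have h𝔫' : 𝔫 ≠ 0 := h𝔫
    haveI := h𝒥fin J hJ
    haveI := hMfin d
    haveI : FiniteDimensional ℂ (Submodule.span ℂ (S 𝔫 J d)) := by
      rw [hS]
      exact harishChandra_finiteness_holds hcpt
        (principalCongruenceLevel_mem_finiteLevelsGL_holds n K h𝔫') J (M d) (hMstab d)
    rw [hF]
    exact (stub_C3 (Submodule.span ℂ (S 𝔫 J d)) (T 𝔫) (hTS h𝔫' J d)).countable
  · -- the eigensystem of a regular algebraic cuspidal `π`
    rintro ⟨π, hπcusp⟩ hπ
    change π.IsRegularAlgebraic at hπ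
    change ∃ c ∈ insert (0 : HeightOneSpectrum (𝓞 K) × Fin (n + 1) → ℂ)
        (⋃ 𝔫 ∈ {𝔫 : Ideal (𝓞 K) | 𝔫 ≠ 0}, ⋃ J ∈ 𝒥, ⋃ d : ℕ, F 𝔫 J d),
      ∀ᶠ v in cofinite, ∀ α : Multiset ℂ, π.HasSatakeParamAt v α →
        ∀ i : Fin (n + 1), heckeEigenvalueOf n v α i = c (v, i)
    by_cases hex : ∃ (v₀ : HeightOneSpectrum (𝓞 K)) (α₀ : Multiset ℂ), π.HasSatakeParamAt v₀ α₀
    swap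
    · refine ⟨0, Set.mem_insert _ _, Filter.Eventually.of_forall fun v α hα => ?_⟩
      exact (hex ⟨v, α, hα⟩).elim
    obtain ⟨v₀, α₀, 𝔫, ϖ₀, h𝔫, -, -, -, φ, hφW, hφW', hfix, -⟩ := hex
    -- stub B: replace `φ` by a form of `W ∖ W'` killed by some `J ∈ 𝒥`
    obtain ⟨ψ₁, hψ₁W, hψ₁W', hinv, J, hJ, hkill₁⟩ := hB π hπ φ hφW hφW'
    have hKfin : principalCongruenceLevel n K 𝔫 ≤ (AutomorphyDatum.gl n K hcpt).finiteAdelic :=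
      (AutomorphyDatum.gl n K hcpt).le_finiteAdelic _
        (principalCongruenceLevel_mem_finiteLevelsGL_holds n K h𝔫)
    have hfix₁ : ∀ u : (AdelicGroupData.gl n K).Adelic, u ∈ principalCongruenceLevel n K 𝔫 →
        rightTranslation (AdelicGroupData.gl n K) u ψ₁ = ψ₁ :=
      fun u hu => hinv u (hKfin hu) (hfix u hu)
    have haut₁ : IsAutomorphicForm (AutomorphyDatum.gl n K hcpt) ψ₁ :=
      isAutomorphicForm_of_mem_automorphicForms_gl (π.stable.le_automorphicForms hψ₁W)
    -- stub A: smear `ψ₁` so that its `K_∞`-slices lie in some `M d`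
    have hW'K : ∀ k : Kinf n K, ∀ ψ ∈ π.W',
        rightTranslation (AdelicGroupData.gl n K) ((AutomorphyDatum.gl n K hcpt).ofK k) ψ ∈ π.W' :=
      fun k ψ hψ => π.stable'.k_stable k hψ
    obtain ⟨ψ, hψspan, hψW', d, hslice⟩ := hA π.W' hW'K ψ₁ haut₁ hψ₁W'
    -- properties of `ψ`
    have hψW : ψ ∈ π.W := by
      refine (Submodule.span_le.2 ?_) hψspan
      rintro _ ⟨k, rfl⟩
      exact π.stable.k_stable k hψ₁W
    have haut : IsAutomorphicForm (AutomorphyDatum.gl n K hcpt) ψ :=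
      isAutomorphicForm_of_mem_automorphicForms_gl (π.stable.le_automorphicForms hψW)
    have hfixψ : ∀ u : (AdelicGroupData.gl n K).Adelic, u ∈ principalCongruenceLevel n K 𝔫 →
        rightTranslation (AdelicGroupData.gl n K) u ψ = ψ := by
      intro u hu
      refine Submodule.span_induction
        (p := fun x _ => rightTranslation (AdelicGroupData.gl n K) u x = x) ?_ ?_ ?_ ?_ hψspan
      · rintro _ ⟨k, rfl⟩
        show rightTranslation (AdelicGroupData.gl n K) u
            (rightTranslation (AdelicGroupData.gl n K) ((AutomorphyDatum.gl n K hcpt).ofK k) ψ₁) =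
          rightTranslation (AdelicGroupData.gl n K) ((AutomorphyDatum.gl n K hcpt).ofK k) ψ₁
        have hc := (AutomorphyDatum.gl n K hcpt).commute_ofArch
          (Subgroup.inclusion (AutomorphyDatum.gl n K hcpt).arch.maximalCompact_le_carrier k) u (hKfin hu)
        rw [AutomorphyDatum.ofK_apply, ← Module.End.mul_apply, ← map_mul]
        erw [← hc]
        rw [map_mul, Module.End.mul_apply, hfix₁ u hu]
      · exact map_zero _
      · intro x y _ _ hx hy
        rw [map_add, hx, hy]
      · intro c x _ hx
        rw [map_smul, hx]
    have hkill : ∀ (p : FreeAlgebra ℝ (archGroupGL n K).lie) (hp : IsCentralWord p),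
        (⟨freeToEnveloping (archGroupGL n K) p, hp⟩ : centerU (archGroupGL n K)) ∈ J →
          applyFree (AutomorphyDatum.gl n K hcpt).ofArch p ψ = 0 := by
      intro p hp hpJ
      have key : ∀ x ∈ Submodule.span ℂ (Set.range fun k : Kinf n K =>
          rightTranslation (AdelicGroupData.gl n K) ((AutomorphyDatum.gl n K hcpt).ofK k) ψ₁),
          IsArchSmooth (AutomorphyDatum.gl n K hcpt).ofArch x ∧
            applyFree (AutomorphyDatum.gl n K hcpt).ofArch p x = 0 := by
        intro x hx
        refine Submodule.span_induction ?_ ?_ ?_ ?_ hx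
        · rintro _ ⟨k, rfl⟩
          have hsm : IsArchSmooth (AutomorphyDatum.gl n K hcpt).ofArch ψ₁ := haut₁.archSmooth
          refine ⟨isArchSmooth_archTranslate (ι := (AutomorphyDatum.gl n K hcpt).ofArch)
            (Subgroup.inclusion (archGroupGL n K).maximalCompact_le_carrier k) hsm, ?_⟩
          show applyFree (AutomorphyDatum.gl n K hcpt).ofArch p
              (archTranslate (AutomorphyDatum.gl n K hcpt).ofArch
                (Subgroup.inclusion (archGroupGL n K).maximalCompact_le_carrier k) ψ₁) = 0
          rw [applyFree_archTranslate_of_isCentralWord (ι := (AutomorphyDatum.gl n K hcpt).ofArch)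
            (archGroupGL_lie n K) (archGroupGL_carrier n K) _ hp hsm, hkill₁ p hp hpJ]
          rfl
        · exact ⟨(archSmooth (AutomorphyDatum.gl n K hcpt).ofArch).zero_mem,
            applyFree_zero_right (ι := (AutomorphyDatum.gl n K hcpt).ofArch) p⟩
        · intro x y _ _ hx hy
          refine ⟨(archSmooth (AutomorphyDatum.gl n K hcpt).ofArch).add_mem hx.1 hy.1, ?_⟩
          rw [applyFree_add_right_of_top (ι := (AutomorphyDatum.gl n K hcpt).ofArch)
            (archGroupGL_lie n K) (archGroupGL_carrier n K) p hx.1 hy.1, hx.2, hy.2, add_zero]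
        · intro c x _ hx
          refine ⟨(archSmooth (AutomorphyDatum.gl n K hcpt).ofArch).smul_mem c hx.1, ?_⟩
          rw [applyFree_smul_right (ι := (AutomorphyDatum.gl n K hcpt).ofArch), hx.2, smul_zero]
      exact (key ψ hψspan).2
    have hψS : ψ ∈ S 𝔫 J d := by
      rw [hS]
      exact ⟨haut, fun u hu g => congrFun (hfixψ u hu) g, hkill, hslice⟩
    have hψX : ψ ∈ Submodule.span ℂ (S 𝔫 J d) := Submodule.subset_span hψS
    -- every element of the span is `K(𝔫)`-invariant
    have hXinv : ∀ x ∈ Submodule.span ℂ (S 𝔫 J d),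
        IsRightInvariantUnder (principalCongruenceLevel n K 𝔫) x := by
      intro x hx
      refine Submodule.span_induction ?_ ?_ ?_ ?_ hx
      · intro y hy
        rw [hS] at hy
        exact hy.2.1
      · exact fun u _ g => rfl
      · intro x y _ _ hx hy u hu g
        simp only [Pi.add_apply, hx u hu g, hy u hu g]
      · intro c x _ hx u hu g
        simp only [Pi.smul_apply, hx u hu g]
    -- the eigencharacter of `ψ` (stub C2), extended by `0` at the places dividing `𝔫`
    let χ : HeightOneSpectrum (𝓞 K) × Fin (n + 1) → ℂ := fun q =>
      if h : ¬ q.1.asIdeal ∣ 𝔫 then Classical.choose (stub_C2 π h𝔫 h (hϖ q.1) (q.2 : ℕ)).2.2 else 0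
    have hχ : ∀ (q : HeightOneSpectrum (𝓞 K) × Fin (n + 1)) (h : ¬ q.1.asIdeal ∣ 𝔫),
        χ q = Classical.choose (stub_C2 π h𝔫 h (hϖ q.1) (q.2 : ℕ)).2.2 := fun q h => dif_pos h
    have hχ' : ∀ (q : HeightOneSpectrum (𝓞 K) × Fin (n + 1)), ¬ ¬ q.1.asIdeal ∣ 𝔫 → χ q = 0 :=
      fun q h => dif_neg h
    have hχF : χ ∈ F 𝔫 J d := by
      rw [hF]
      refine ⟨Submodule.span ℂ (S 𝔫 J d) ⊓ π.W, Submodule.span ℂ (S 𝔫 J d) ⊓ π.W',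
        inf_le_left, inf_le_left, ?_, ?_, ψ, ⟨hψX, hψW⟩, fun h => hψW' h.2, ?_⟩
      · rintro ⟨v, j⟩ y ⟨hyX, hyW⟩
        refine ⟨hTS h𝔫 J d _ y hyX, ?_⟩
        by_cases hvj : ¬ v.asIdeal ∣ 𝔫
        · have h1 := (stub_C2 π h𝔫 hvj (hϖ v) j).1 y hyW (hXinv y hyX)
          rw [← hT₁ 𝔫 (v, j) hvj] at h1
          exact h1
        · rw [hT₀ 𝔫 (v, j) hvj, LinearMap.zero_apply]
          exact Submodule.zero_mem _
      · rintro ⟨v, j⟩ y ⟨hyX, hyW'⟩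
        refine ⟨hTS h𝔫 J d _ y hyX, ?_⟩
        by_cases hvj : ¬ v.asIdeal ∣ 𝔫
        · have h1 := (stub_C2 π h𝔫 hvj (hϖ v) j).2.1 y hyW' (hXinv y hyX)
          rw [← hT₁ 𝔫 (v, j) hvj] at h1
          exact h1
        · rw [hT₀ 𝔫 (v, j) hvj, LinearMap.zero_apply]
          exact Submodule.zero_mem _
      · rintro ⟨v, j⟩
        refine ⟨Submodule.sub_mem _ (hTS h𝔫 J d _ ψ hψX) (Submodule.smul_mem _ _ hψX), ?_⟩
        by_cases hvj : ¬ v.asIdeal ∣ 𝔫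
        · have h1 := (Classical.choose_spec (stub_C2 π h𝔫 hvj (hϖ v) j).2.2).1 ψ hψW (hXinv ψ hψX)
          rw [hT₁ 𝔫 (v, j) hvj, hχ (v, j) hvj]
          exact h1
        · have h0 : T 𝔫 (v, j) ψ - χ (v, j) • ψ = 0 := by
            rw [hT₀ 𝔫 (v, j) hvj, hχ' (v, j) hvj, LinearMap.zero_apply, zero_smul, sub_zero]
          rw [h0]
          exact π.W'.zero_mem
    refine ⟨χ, Set.mem_insert_of_mem _ ?_, ?_⟩
    · exact Set.mem_iUnion₂.2 ⟨𝔫, h𝔫, Set.mem_iUnion₂.2 ⟨J, hJ, Set.mem_iUnion.2 ⟨d, hχF⟩⟩⟩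
    · have hcof : ∀ᶠ v : HeightOneSpectrum (𝓞 K) in cofinite, ¬ v.asIdeal ∣ 𝔫 :=
        (Ideal.finite_factors h𝔫).compl_mem_cofinite
      filter_upwards [hcof] with v hv α hα j
      rw [hχ (v, j) hv]
      exact ((Classical.choose_spec (stub_C2 π h𝔫 hv (hϖ v) j).2.2).2 α hα
        (Nat.lt_succ_iff.1 j.2)).symm


/-- **(S4), from the stubs A, B, C1, C2, C3** (`countable_heckeEigensystems`): for every `n, K` a
countable set of functions on (places × `{0,…,n}`) such that the unramified Hecke eigensystem of
every regular algebraic cuspidal `π` on `GL_n(𝔸_K)` agrees, at all but finitely many places, with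
one of them. [folklore] -/
theorem S4_of_stubs : ∀ (n : ℕ) (K : Type) [Field K] [NumberField K]
    (hcpt : isCompact_glFiniteIntegralLevel n K),
    ∃ 𝒞 : Set (HeightOneSpectrum (𝓞 K) × Fin (n + 1) → ℂ), 𝒞.Countable ∧
      ∀ π : CuspidalAutomorphicRepData n K hcpt, π.1.IsRegularAlgebraic →
        ∃ c ∈ 𝒞, ∀ᶠ v in cofinite, ∀ α : Multiset ℂ, π.1.HasSatakeParamAt v α →
          ∀ i : Fin (n + 1), heckeEigenvalueOf n v α i = c (v, i) :=
  fun _ _ _ _ hcpt => countable_heckeEigensystems hcpt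

end Summit.Langlands.Langlands.Theorems.HeckeEigenvalueField.Baire

end
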